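import Literature.AnabelianGeometry.EtaleTheta.Thm56SubdagStatements
import Literature.AnabelianGeometry.EtaleTheta.FrobenioidThetaOfBiKummerData
import Literature.AnabelianGeometry.EtaleTheta.ThetaRigidity
import HarnessLib

/-!
# [EtTh] §1 p.238 (PDF p.12) «`Δ_Θ` is a quotient of `Π^tp_Ÿ`» ⇒ the coverage input `LDeltaCovered` of Prop. 5.5 /
# Thm. 5.6 (i) AT THE §5 CARRIER `ThetaFrobenioid.ofBiKummerData` (proof-only)

Mochizuki, *The étale theta function and its Frobenioid-theoretic manifestations*, Publ. RIMS **45** (2009), §1 p.238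
(PDF p.12): "we have a natural exact sequence `1 → Δ_Θ → (Δ^tp_Y)^Θ → (Δ^tp_Y)^ell → 1`" — `Δ_Θ`, hence `l·Δ_Θ` and its
reduction `(l·Δ_Θ) ⊗ ℤ/Nℤ ≅ μ_N` (§2 p.272 (PDF p.46)), is a QUOTIENT of a subgroup of `Π^tp_Ÿ`
[cite: MochizukiEtTh2009, §1 p.238 (PDF p.12)].  In the proof of Prop. 5.5 (p.327–328) this is the tacit input that the
part of `H_{B_N}` over `(l·Δ_Θ)_{B_N}` maps ONTO `(l·Δ_Θ)_{B_N} ⊗ ℤ/Nℤ`, recorded by abc-iut-w5-d020 as the sub-DAG input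
`ThetaFrobenioid.Thm56Sub.LDeltaCovered` (Thm56SubdagStatements.lean l.229; = abc-iut-L2-t11's former hypothesis `hcov`
of `Discharge/Sec5RigidityGlue`), consumed by the assembly rows P55-A / T56-L09 of plan/L2/SUBDAG-EtTh-Thm56.md.

abc-iut cell, layer L2, abc-iut-L2-lead ROW #2 for seat abc-iut-w5-d123 (2026-08-26T03:08Z).  PROOF-ONLY (0 definitions,
0 new named facts); sequel of `Discharge/Sec5Prop55EtaTautological.lean` (p418694: same carrier, same row-2 binders).
Over a §2 `RigidData` (abc-iut-L2-t2's interface, `ThetaRigidity.lean`; for the §1 setting: abc-iut-L2-t8's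
`C.rigidData μ hC hS h15 L`) the printed input IS packaged: `RigidData.lDeltaTheta_le` («`θ⁻¹(l·Δ_Θ) ⊆ Π^tp_Ÿ ∩ Ker aug`»)
and `RigidData.thetaMod_surjective` («`θ⁻¹(l·Δ_Θ) ↠ (l·Δ_Θ) ⊗ ℤ/Nℤ = μ_N`»).  Pushing along
`ρ = rhoOfBiKummerData R ιX : Π^tp_X ↠ Aut_D(B_N^bs)` to `H_{B_N} = ρ(Π^tp_Ÿ)` needs only the ROW-2 laws of the real
subquotient datum `P` at `B_N^bs` (MERGE-PLAN row 2, abc-iut-L2-t9 / abc-iut-L2-t4; GAP-LEDGER G-w5d123-2, same class —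
no new GAP row): `hpre` (`ρ` maps `Π^tp_Ÿ ∩ θ⁻¹(l·Δ_Θ)` INTO `P.pre (B_N^bs)`), `hP` (`P.proj ∘ ρ = e ∘ thetaMod` there) and
the surjectivity `he` of the coefficient identification `e : μ_N → (l·Δ_Θ)_{B_N} ⊗ ℤ/Nℤ` («the natural isomorphism»).

* `ThetaFrobenioid.lDeltaCovered_ofBiKummerData` — `LDeltaCovered 𝔉 P` for `𝔉 := ofBiKummerData …` over a `RigidData`,
  modulo `hpre`, `hP`, `he`.
HONEST FRAMING: conditional on the row-2 binders; [EtTh] is refereed; nothing here bears on [IUTchIII] Cor. 3.12.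
-/

noncomputable section

namespace Literature.AnabelianGeometry.EtaleTheta

open CategoryTheory FrobenioidCyclotomicRigidity Literature.AlgebraicGeometry.Frobenioids

universe u₀ v₀ u v w

namespace ThetaFrobenioid

variable {K : Type u₀} [Field K]
  {X : SemiGraphs.TemperedArithmeticGroup.{u₀} K} {D₀ : Type u₀} [Category.{v₀} D₀]
  {V : FrdIMonoidStub.{w}} {T₀ : RealifiedDivisorMonoids (D₀ := D₀) V} {D : Type u} [Category.{v} D]
  {VD : FrdICatStub.{u, v, w} D} {S : BiKummerSetting X T₀ D VD}
  {pullFrac : ∀ {A A' : S.C} (_ : A' ⟶ A), S.biratUnits A → S.biratUnits A'}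
  {lv N : ℕ+} {l' : ℕ} {RD : RigidData.{max v w} N l'} {θ : S.biratUnits S.Aodot} {Bl : S.C}
  {Pl : S.FractionPair θ Bl} {Rl : S.NthRoot θ Pl lv pullFrac}
  (h : ModelFrobenioid.Hypotheses S.tf.divisorMonoid S.tf.ratFnFunctor)
  (toB : ∀ A : S.C, S.biratUnits A →* S.tf.biratUnitsModel A) (Q : FrobenioidTheta.ThetaSubquotientStub.{w} D)
  (odd_l : Odd (lv : ℕ)) (R : S.NthRoot Rl.root Rl.pair N pullFrac) (ιX : RD.PiX ≃ₜ* X.Pi)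
  (hopen : IsOpen ((S.galoisSurj R.AN.base R.αData.isGalois).ker : Set X.Pi)) (σ : Aut R.AN.base →* Aut R.AN)
  (K' : Type w) [Field K'] (constEmb : K'ˣ →* S.tf.biratUnitsModel R.BN)
  (constEmb_injective : Function.Injective constEmb)
  (hdivc : ∀ g : Aut R.BN.base,
    ModelFrobenioid.div ((σ ((BiKummerSetting.NthRoot.baseIso S R).conjAut.symm g)).hom ≫ R.pair.num) =
      ModelFrobenioid.div R.pair.num)
  (hdivp : ∀ y : RD.PiYdd,
    ModelFrobenioid.div ((σ (S.galoisSurj R.AN.base R.αData.isGalois (ιX y.1))).hom ≫ R.pair.den) =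
      ModelFrobenioid.div R.pair.den)

/-- **`LDeltaCovered` at the carrier** («`Δ_Θ` is a quotient of `Π^tp_Ÿ`», §1 p.238 (PDF p.12); sub-DAG input of
Prop. 5.5 / Thm. 5.6 (i), = abc-iut-L2-t11's `hcov`): for `𝔉 := ofBiKummerData …` over a §2 `RigidData` and a subquotient
datum `P` satisfying the row-2 laws `hpre` (`ρ(Π^tp_Ÿ ∩ θ⁻¹(l·Δ_Θ)) ⊆ P.pre (B_N^bs)`) and `hP` (`P.proj ∘ ρ = e ∘ thetaMod`),
with `e : μ_N → (l·Δ_Θ)_{B_N} ⊗ ℤ/Nℤ` onto, EVERY element of `(l·Δ_Θ)_{B_N} ⊗ ℤ/Nℤ` is the class of `P.proj h` for some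
`h ∈ H_{B_N}` over `(l·Δ_Θ)_{B_N}`: take `k ∈ θ⁻¹(l·Δ_Θ) ⊆ Π^tp_Ÿ` with `thetaMod k` the wanted value
(`RigidData.thetaMod_surjective`, `RigidData.lDeltaTheta_le`) and `h := ρ k`.
[cite: MochizukiEtTh2009, §1 p.238 (PDF p.12)] -/
theorem lDeltaCovered_ofBiKummerData
    (e : RD.mu → (ofBiKummerData h toB Q odd_l R ιX hopen σ K' constEmb constEmb_injective hdivc hdivp).lDeltaModN
      (ofBiKummerData h toB Q odd_l R ιX hopen σ K' constEmb constEmb_injective hdivc hdivp).BN)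
    (he : Function.Surjective e)
    (P : ThetaSubquotientProj (ofBiKummerData h toB Q odd_l R ιX hopen σ K' constEmb constEmb_injective hdivc hdivp))
    (hpre : ∀ k : RD.PiYdd, (k : RD.PiX) ∈ RD.lDeltaTheta → rhoOfBiKummerData R ιX k ∈ P.pre _)
    (hP : ∀ (k : RD.PiYdd) (hk : (k : RD.PiX) ∈ RD.lDeltaTheta) (hm : rhoOfBiKummerData R ιX k ∈ P.pre _),
      (QuotientGroup.mk (P.proj _ ⟨rhoOfBiKummerData R ιX k, hm⟩) :
          (ofBiKummerData h toB Q odd_l R ιX hopen σ K' constEmb constEmb_injective hdivc hdivp).lDeltaModN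
            (ofBiKummerData h toB Q odd_l R ιX hopen σ K' constEmb constEmb_injective hdivc hdivp).BN) =
        e (RD.thetaMod ⟨k, hk⟩)) :
    Thm56Sub.LDeltaCovered (ofBiKummerData h toB Q odd_l R ιX hopen σ K' constEmb constEmb_injective hdivc hdivp) P := by
  intro x
  obtain ⟨m, rfl⟩ := he x
  obtain ⟨g, rfl⟩ := RD.thetaMod_surjective m
  -- `g ∈ θ⁻¹(l·Δ_Θ) ⊆ Π^tp_Ÿ`
  have hgY : (g : RD.PiX) ∈ RD.PiYdd := (Subgroup.mem_inf.mp (RD.lDeltaTheta_le g.2)).1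
  have hk : ((⟨(g : RD.PiX), hgY⟩ : RD.PiYdd) : RD.PiX) ∈ RD.lDeltaTheta := g.2
  refine ⟨⟨rhoOfBiKummerData R ιX (⟨(g : RD.PiX), hgY⟩ : RD.PiYdd), Subgroup.mem_map_of_mem _ hgY⟩,
    hpre ⟨(g : RD.PiX), hgY⟩ hk, ?_⟩
  rw [hP ⟨(g : RD.PiX), hgY⟩ hk (hpre ⟨(g : RD.PiX), hgY⟩ hk)]

end ThetaFrobenioid

end Literature.AnabelianGeometry.EtaleTheta

end
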